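import Summits.QuantumAdvantage.QuantumAdvantage.Theses.SymplecticPurity

/-!
# Route `SymplecticPurity`, item `Assembly` (stmt-QuantumAdvantage-9843)

The assembly item of route `QuantumAdvantage/SymplecticPurity`:
`FFThesis → SymplecticPurityBound → CubeGraphFlat → DlogGraphFlat → GaussianDegreeBound →
CompositeFrameBound → GraphStateSpectrum → CubeAlmostBent → NoFreeFrame → ¬ QuantumAdvantage`.

Pure logic: only the first hypothesis `FFThesis` (`BQP ⊆ BPP`) is used, against the summit
statement `QuantumAdvantage := ∃ L, L ∈ BQP ∧ L ∉ BPP` (Bernstein–Vazirani 1997, §8; Aaronson 2010,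
§1). The remaining eight hypotheses (the kills of the free-frame road) are inert in the term, exactly
as in the route's deciding theorem `closes`.
-/

set_option linter.dupNamespace false -- D-0017: single-problem summit ⇒ `QuantumAdvantage.QuantumAdvantage` by design

namespace Summit.QuantumAdvantage.QuantumAdvantage.Theorems.SymplecticPurity

/-- Settles `stmt-QuantumAdvantage-9843` (route SymplecticPurity, assembly): if `BQP ⊆ BPP`
(`FFThesis`) then there is no `L ∈ BQP ∖ BPP`, i.e. `¬ QuantumAdvantage`; the other eight route
items enter only as unused hypotheses. [cite: BernsteinVazirani1997, §8] [cite: Aaronson2010, §1] -/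
theorem Assembly_proof :
    Summit.QuantumAdvantage.QuantumAdvantage.Theses.SymplecticPurity.Assembly := by
  unfold Summit.QuantumAdvantage.QuantumAdvantage.Theses.SymplecticPurity.Assembly
  intro h0 _ _ _ _ _ _ _ _
  rintro ⟨L, hq, hn⟩
  exact hn (h0 hq)

end Summit.QuantumAdvantage.QuantumAdvantage.Theorems.SymplecticPurity
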